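import Literature.Barriers.CriticalPhenomena.PlaquetteWalkHoleRootHoleColumnAdjacent
import Literature.Barriers.CriticalPhenomena.PlaquetteWalkHoleRootHoleColumnAdjacentVertical
import HarnessLib

/-!
# Barrier catalogue (SAWScalingLimit): THE CLASS-`B2a` LAW NEXT TO THE HOLE — every wound class-`B2a` walk of limit cost `7` at `(w.1 − 1, w.2 ± 1)` ends on the far
slanted side and has limit weight in a three-phase antipode-free set («HOLE COLUMN NEXT TO THE HOLE: THE CLASS-B2a LAW»)

`Z → ∞` limit model of the printed Yang–Baxter weights [GlazmanManolescu2019, §1, eq. (1)]; the «RECTANGLE COEFFICIENT» line (b-engine-1 g29). The two companions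
`PlaquetteWalkHoleRootHoleColumnAdjacent` (slanted ends: the phase law with no structural hypothesis) and `PlaquetteWalkHoleRootHoleColumnAdjacentVertical` (vertical
ends: none) combine into a statement about EVERY wound class-`B2a` walk of limit cost `7` at the two hole-column cells next to the hole, whatever its end side:

* ★★★ `ΩG.end_eq_N_of_cost_seven_holeColumn_adjacent_above` / `…_eq_S_…_below` — the end is the FAR slanted side (`N` above the hole, `S` below);
* ★★★ `ΩG.limitWeight_mem_of_cost_seven_holeColumn_adjacent_above` — at `r = (w.1 − 1, w.2 + 1)`:
  `limitWeight ∈ {(√2)⁷ζ²⁸, (√2)⁷ζ⁸, (√2)⁷ζ¹⁶}` and `phaseIndex ∈ {1, 4, 6}` (census phases `k = 7, 2, 4`);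
* ★★★ `ΩG.limitWeight_mem_of_cost_seven_holeColumn_adjacent_below` — at `r = (w.1 − 1, w.2 − 1)`:
  `limitWeight ∈ {(√2)⁷ζ⁸, (√2)⁷ζ²⁸, (√2)⁷ζ²⁰}` and `phaseIndex ∈ {0, 3, 5}` (census phases `k = 2, 7, 5`).

So the class-`B2a` summand of the level-`7` wound sum `Λ₇` at the cells next to the hole is a non-negative integer combination of three eighth roots of unity with no
antipodal pair (`PlaquetteWalkAngleLimitAntipode`); the class-`B2b` summand (extensions of the cost-`9` `NS` parents; census kit j298353: the same three phases) is what
remains before `Λ₇ ≠ 0 ⟺ a member exists` there.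

[GlazmanManolescu2019 §1 eq. (1), Lemma 2.1, Remark 2.2, §4.2; Glazman2015WeightedSAW Lemma 3.1 (proof); the `Z → ∞` bookkeeping is lane plumbing.]
-/

noncomputable section

namespace Literature.Probability.RandomPlanarGeometry.SAW.YangBaxter

open Real
open Literature.Barriers.CriticalPhenomena.PlaquetteWalk

namespace ΩG

variable {D : Set Face} {w r : Face} {ω : ΩG D (w.side .W) r}

/-- The four end sides. [cite: GlazmanManolescu2019, §1, Fig. 4 (z_W, z_E, z_S, z_N)] -/
private theorem side_cases (s : Side) : (s = .N ∨ s = .S) ∨ (s = .E ∨ s = .W) := by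
  cases s
  · exact Or.inr (Or.inr rfl)
  · exact Or.inr (Or.inl rfl)
  · exact Or.inl (Or.inr rfl)
  · exact Or.inl (Or.inl rfl)

/-- ★★★ **NEXT TO THE HOLE, ABOVE: EVERY LEVEL-`7` CLASS-`B2a` MEMBER ENDS ON `N`.** A wound class-`B2a` walk of limit cost `7` from the hole root `w.side W` (hole
`(w.1 − 1, w.2)` absent) at `r = (w.1 − 1, w.2 + 1)` ends on the `N` side of `r`: a vertical end is impossible (`not_cost_seven_vertical_holeColumn_adjacent_above`) and a
slanted end is the far one (`limitWeight_of_cost_seven_slanted_holeColumn_adjacent_above`). [cite: GlazmanManolescu2019, §1, Fig. 1 and eq. (1); Lemma 2.1; Remark 2.2]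
[cite: Glazman2015WeightedSAW, Lemma 3.1 (proof, pp. 6–7)] -/
theorem end_eq_N_of_cost_seven_holeColumn_adjacent_above (hh : holeFaceW w ∉ D) (hr : RootedFace D (w.side .W) r) (h : ω.IsB2a)
    (hA : ω.AJ hr h (toC (midPt (w.side .W))) ≠ 0) (hc : cost (slotOfSide ω.1) ω.2.mids = 7) (hcol : r.1 = w.1 - 1) (hadj : r.2 = w.2 + 1) :
    ω.1 = .N := by
  rcases side_cases ω.1 with hz | hzv
  · exact (limitWeight_of_cost_seven_slanted_holeColumn_adjacent_above hh hr h hA hc hz hcol hadj).1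
  · exact absurd (not_cost_seven_vertical_holeColumn_adjacent_above hh hr h hA hc hzv hcol hadj) not_false

/-- ★★★ **NEXT TO THE HOLE, BELOW: EVERY LEVEL-`7` CLASS-`B2a` MEMBER ENDS ON `S`.** [cite: GlazmanManolescu2019, §1, Fig. 1 and eq. (1); Lemma 2.1; Remark 2.2; §4.2]
[cite: Glazman2015WeightedSAW, Lemma 3.1 (proof, pp. 6–7)] -/
theorem end_eq_S_of_cost_seven_holeColumn_adjacent_below (hh : holeFaceW w ∉ D) (hr : RootedFace D (w.side .W) r) (h : ω.IsB2a)
    (hA : ω.AJ hr h (toC (midPt (w.side .W))) ≠ 0) (hc : cost (slotOfSide ω.1) ω.2.mids = 7) (hcol : r.1 = w.1 - 1) (hadj : r.2 = w.2 - 1) :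
    ω.1 = .S := by
  rcases side_cases ω.1 with hz | hzv
  · exact (limitWeight_of_cost_seven_slanted_holeColumn_adjacent_below hh hr h hA hc hz hcol hadj).1
  · exact absurd (not_cost_seven_vertical_holeColumn_adjacent_below hh hr h hA hc hzv hcol hadj) not_false

/-- ★★★ **THE CLASS-`B2a` LAW NEXT TO THE HOLE, ABOVE.** Every wound class-`B2a` walk of limit cost `7` from the hole root `w.side W` (hole `(w.1 − 1, w.2)` absent) at
`r = (w.1 − 1, w.2 + 1)` — whatever its end side — has `limitWeight ∈ {(√2)⁷ζ²⁸, (√2)⁷ζ⁸, (√2)⁷ζ¹⁶}` (`ζ = e^{iπ/16}`; census phases `7, 2, 4`) and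
`phaseIndex ∈ {1, 4, 6}`: three phases, no antipodal pair. [cite: GlazmanManolescu2019, §1, Fig. 1 and eq. (1); Lemma 2.1, eq. (CR); §2.1, eq. (2.1)]
[cite: Glazman2015WeightedSAW, Lemma 3.1 (proof, pp. 6–7)] -/
theorem limitWeight_mem_of_cost_seven_holeColumn_adjacent_above (hh : holeFaceW w ∉ D) (hr : RootedFace D (w.side .W) r) (h : ω.IsB2a)
    (hA : ω.AJ hr h (toC (midPt (w.side .W))) ≠ 0) (hc : cost (slotOfSide ω.1) ω.2.mids = 7) (hcol : r.1 = w.1 - 1) (hadj : r.2 = w.2 + 1) :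
    (limitWeight (slotOfSide ω.1) ω.2.mids = ((Real.sqrt 2 : ℝ) : ℂ) ^ 7 * zeta32 ^ 28 ∨
      limitWeight (slotOfSide ω.1) ω.2.mids = ((Real.sqrt 2 : ℝ) : ℂ) ^ 7 * zeta32 ^ 8 ∨
      limitWeight (slotOfSide ω.1) ω.2.mids = ((Real.sqrt 2 : ℝ) : ℂ) ^ 7 * zeta32 ^ 16) ∧
    (phaseIndex ω.2.mids = 1 ∨ phaseIndex ω.2.mids = 4 ∨ phaseIndex ω.2.mids = 6) := by
  rcases side_cases ω.1 with hz | hzv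
  · exact limitWeight_mem_of_cost_seven_slanted_holeColumn_adjacent_above hh hr h hA hc hz hcol hadj
  · exact absurd (not_cost_seven_vertical_holeColumn_adjacent_above hh hr h hA hc hzv hcol hadj) not_false

/-- ★★★ **THE CLASS-`B2a` LAW NEXT TO THE HOLE, BELOW.** Every wound class-`B2a` walk of limit cost `7` from the hole root at `r = (w.1 − 1, w.2 − 1)` has
`limitWeight ∈ {(√2)⁷ζ⁸, (√2)⁷ζ²⁸, (√2)⁷ζ²⁰}` (census phases `2, 7, 5`) and `phaseIndex ∈ {0, 3, 5}`.
[cite: GlazmanManolescu2019, §1, Fig. 1 and eq. (1); Lemma 2.1, eq. (CR); §2.1, eq. (2.1); §4.2 (lattice symmetries)] [cite: Glazman2015WeightedSAW, Lemma 3.1 (proof, pp. 6–7)] -/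
theorem limitWeight_mem_of_cost_seven_holeColumn_adjacent_below (hh : holeFaceW w ∉ D) (hr : RootedFace D (w.side .W) r) (h : ω.IsB2a)
    (hA : ω.AJ hr h (toC (midPt (w.side .W))) ≠ 0) (hc : cost (slotOfSide ω.1) ω.2.mids = 7) (hcol : r.1 = w.1 - 1) (hadj : r.2 = w.2 - 1) :
    (limitWeight (slotOfSide ω.1) ω.2.mids = ((Real.sqrt 2 : ℝ) : ℂ) ^ 7 * zeta32 ^ 8 ∨
      limitWeight (slotOfSide ω.1) ω.2.mids = ((Real.sqrt 2 : ℝ) : ℂ) ^ 7 * zeta32 ^ 28 ∨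
      limitWeight (slotOfSide ω.1) ω.2.mids = ((Real.sqrt 2 : ℝ) : ℂ) ^ 7 * zeta32 ^ 20) ∧
    (phaseIndex ω.2.mids = 0 ∨ phaseIndex ω.2.mids = 3 ∨ phaseIndex ω.2.mids = 5) := by
  rcases side_cases ω.1 with hz | hzv
  · exact limitWeight_mem_of_cost_seven_slanted_holeColumn_adjacent_below hh hr h hA hc hz hcol hadj
  · exact absurd (not_cost_seven_vertical_holeColumn_adjacent_below hh hr h hA hc hzv hcol hadj) not_false

end ΩG

end Literature.Probability.RandomPlanarGeometry.SAW.YangBaxter
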